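import Summits.QuantumFields.GaugeBoot.TiltedBoxSiteRP
import Literature.MathematicalPhysics.QuantumLattice.GaugeGroups
import HarnessLib

/-!
# The tilted-box reflection positivities for the venture's gauge groups `SU(N)`, `U(N)`
(gauge-boot, L3(σ)/L3(τ) — non-vacuity of the instances)

HONEST FRAMING (cell `pub-gaugeboot`, page 1 of every file): the venture produces certified bounds
on lattice expectations at stated coupling, gauge group, dimension and torus size; NOT a mass gap,
NOT a continuum limit, NOT a string tension; NOT Yang–Mills-summit-bearing (barriers
`FixedCouplingUltralocality`, `PerturbativeInvisibility`).

`TiltedBox.tiltedBox_diagonalRP` (diagonal RP, `x_i = x_j`) and `TiltedBoxSiteRP.tiltedBox_siteRP`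
(site-hyperplane RP along an axis `k ∉ {i, j}`) are stated for an arbitrary compact second countable
topological group `G` with its Borel σ-algebra and a continuous matrix representation `ρ`. This
file records that the hypotheses are met — all instances are found by Mathlib and the tree's
`Literature/MathematicalPhysics/QuantumLattice/GaugeGroups.lean` — for the gauge groups the cell's
certificates are about: `SU(N)` (`Matrix.specialUnitaryGroup (Fin N) ℂ` with the fundamental
representation `fundamentalRep`) and `U(N)` (`Matrix.unitaryGroup (Fin N) ℂ`,
`unitaryFundamentalRep`), every `N` (second countability of the matrix groups is supplied inline,
as in `DiagonalRPTorusNegativeOddSUN.lean`). Nothing else is claimed.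

References: J. Fröhlich, R. Israel, E. H. Lieb, B. Simon, J. Stat. Phys. 22 (1980) 297, §3;
K. Osterwalder, E. Seiler, Ann. Phys. 110 (1978) 440, §2.
-/

noncomputable section

open MeasureTheory Complex
open scoped ComplexOrder ComplexConjugate
open Literature.MathematicalPhysics.QuantumLattice

namespace Summit.QuantumFields.GaugeBoot

namespace TiltedRP

variable {d : ℕ} {i j k : Fin d} {Mu Mv L Q N : ℕ} [NeZero Mu] [NeZero Mv]

/-! ## `SU(N)` -/

/-- **Diagonal RP of `SU(N)` lattice Yang–Mills on the 45°-tilted periodic box** (fundamental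
representation; `β ≥ 0`, `i ≠ j`, `M_v ≥ 2`; every `N`). -/
theorem tiltedBox_diagonalRP_suN [NeZero L] (hij : i ≠ j) (hMv : 2 ≤ Mv) {β : ℝ} (hβ : 0 ≤ β)
    (F : Config (TiltedSite d i j Mu Mv L) d (Matrix.specialUnitaryGroup (Fin N) ℂ) → ℂ)
    (hFm : Measurable F) (hFb : ∃ C : ℝ, ∀ U, ‖F U‖ ≤ C)
    (hFo : IsHalfObservable (tiltedUnit d i j Mu Mv L) Mv (tiltedHeight d i j Mu Mv L) F) :
    0 ≤ ∫ U, conj (F (configSwap i j (tiltedMirror d i j Mu Mv L) U)) * F U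
      ∂(gibbs (fundamentalRep (Fin N)) (tiltedUnit d i j Mu Mv L) β) := by
  haveI : SecondCountableTopology (Matrix (Fin N) (Fin N) ℂ) :=
    inferInstanceAs (SecondCountableTopology (Fin N → Fin N → ℂ))
  haveI : SecondCountableTopology (Matrix.specialUnitaryGroup (Fin N) ℂ) :=
    Topology.IsEmbedding.subtypeVal.secondCountableTopology
  exact tiltedBox_diagonalRP (fundamentalRep (Fin N)) hij hMv (continuous_fundamentalRep (Fin N))
    hβ F hFm hFb hFo

/-- **Site-hyperplane RP of `SU(N)` lattice Yang–Mills on the tilted box along an axis `k ∉ {i, j}`**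
(`L = 2Q`, `Q ≥ 2`, `β ≥ 0`; every `N`). -/
theorem tiltedBox_siteRP_suN [NeZero Q] (hki : k ≠ i) (hkj : k ≠ j) (hQ : 2 ≤ Q) {β : ℝ}
    (hβ : 0 ≤ β)
    (F : Config (TiltedSite d i j Mu Mv (2 * Q)) d (Matrix.specialUnitaryGroup (Fin N) ℂ) → ℂ)
    (hFm : Measurable F) (hFb : ∃ C : ℝ, ∀ U, ‖F U‖ ≤ C)
    (hFo : IsHalfObservable (tiltedUnit d i j Mu Mv (2 * Q)) Q (tiltedCoord d Mu Mv (2 * Q) hki hkj) F) :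
    0 ≤ ∫ U, conj (F (configReflect (tiltedUnit d i j Mu Mv (2 * Q)) k
        (tiltedReflect d Mu Mv (2 * Q) hki hkj) U)) * F U
      ∂(gibbs (fundamentalRep (Fin N)) (tiltedUnit d i j Mu Mv (2 * Q)) β) := by
  haveI : SecondCountableTopology (Matrix (Fin N) (Fin N) ℂ) :=
    inferInstanceAs (SecondCountableTopology (Fin N → Fin N → ℂ))
  haveI : SecondCountableTopology (Matrix.specialUnitaryGroup (Fin N) ℂ) :=
    Topology.IsEmbedding.subtypeVal.secondCountableTopology
  exact tiltedBox_siteRP (fundamentalRep (Fin N)) hki hkj hQ (continuous_fundamentalRep (Fin N))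
    hβ F hFm hFb hFo

/-! ## `U(N)` -/

/-- **Diagonal RP of `U(N)` lattice gauge theory on the 45°-tilted periodic box** (fundamental
representation; `β ≥ 0`, `i ≠ j`, `M_v ≥ 2`; every `N`, `U(1)` included). -/
theorem tiltedBox_diagonalRP_uN [NeZero L] (hij : i ≠ j) (hMv : 2 ≤ Mv) {β : ℝ} (hβ : 0 ≤ β)
    (F : Config (TiltedSite d i j Mu Mv L) d (Matrix.unitaryGroup (Fin N) ℂ) → ℂ)
    (hFm : Measurable F) (hFb : ∃ C : ℝ, ∀ U, ‖F U‖ ≤ C)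
    (hFo : IsHalfObservable (tiltedUnit d i j Mu Mv L) Mv (tiltedHeight d i j Mu Mv L) F) :
    0 ≤ ∫ U, conj (F (configSwap i j (tiltedMirror d i j Mu Mv L) U)) * F U
      ∂(gibbs (unitaryFundamentalRep (Fin N) ℂ) (tiltedUnit d i j Mu Mv L) β) := by
  haveI : SecondCountableTopology (Matrix (Fin N) (Fin N) ℂ) :=
    inferInstanceAs (SecondCountableTopology (Fin N → Fin N → ℂ))
  haveI : SecondCountableTopology (Matrix.unitaryGroup (Fin N) ℂ) :=
    Topology.IsEmbedding.subtypeVal.secondCountableTopology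
  exact tiltedBox_diagonalRP (unitaryFundamentalRep (Fin N) ℂ) hij hMv
    (continuous_unitaryFundamentalRep (n := Fin N) (𝕜 := ℂ)) hβ F hFm hFb hFo

/-- **Site-hyperplane RP of `U(N)` lattice gauge theory on the tilted box along an axis
`k ∉ {i, j}`** (`L = 2Q`, `Q ≥ 2`, `β ≥ 0`; every `N`). -/
theorem tiltedBox_siteRP_uN [NeZero Q] (hki : k ≠ i) (hkj : k ≠ j) (hQ : 2 ≤ Q) {β : ℝ}
    (hβ : 0 ≤ β)
    (F : Config (TiltedSite d i j Mu Mv (2 * Q)) d (Matrix.unitaryGroup (Fin N) ℂ) → ℂ)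
    (hFm : Measurable F) (hFb : ∃ C : ℝ, ∀ U, ‖F U‖ ≤ C)
    (hFo : IsHalfObservable (tiltedUnit d i j Mu Mv (2 * Q)) Q (tiltedCoord d Mu Mv (2 * Q) hki hkj) F) :
    0 ≤ ∫ U, conj (F (configReflect (tiltedUnit d i j Mu Mv (2 * Q)) k
        (tiltedReflect d Mu Mv (2 * Q) hki hkj) U)) * F U
      ∂(gibbs (unitaryFundamentalRep (Fin N) ℂ) (tiltedUnit d i j Mu Mv (2 * Q)) β) := by
  haveI : SecondCountableTopology (Matrix (Fin N) (Fin N) ℂ) :=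
    inferInstanceAs (SecondCountableTopology (Fin N → Fin N → ℂ))
  haveI : SecondCountableTopology (Matrix.unitaryGroup (Fin N) ℂ) :=
    Topology.IsEmbedding.subtypeVal.secondCountableTopology
  exact tiltedBox_siteRP (unitaryFundamentalRep (Fin N) ℂ) hki hkj hQ
    (continuous_unitaryFundamentalRep (n := Fin N) (𝕜 := ℂ)) hβ F hFm hFb hFo

end TiltedRP

end Summit.QuantumFields.GaugeBoot
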